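import Summits.KontsevichZagierPeriods.Zeta5Search.Barrier.ConeGammaTranslateUnitExchange

/-!
# ζ(5) search — BARRIER: EVERY KINK OF THE TRANSLATE INTEGRAL ACROSS A SIMPLE RESONANCE WALL IS A UNIT KINK — the per-period
# signed jump masses of two translates that differ by the order of ONE adjacent pair of crossings differ by `m·(e_{k₂} − e_{k₁})`,
# `m ∈ {−1,0,1}` (certificate-style; sequel to «THE CLOSED-ORBIT LIMIT», file (7))

HONEST FRAMING (cell `pub-zeta5`): systematic search; no irrationality claim unless kernel-certified. MODEL objects
under Brown–Zudilin's (28)+(30) accounting ([BZ22] = arXiv:2210.03391; (28) observed, not proved); nothing here is a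
statement about `ζ(5)`, any `γ` of record, the cone's supremum (C2 OPEN) or any jump / wall / translate at a named direction
(DATA of the cell); NO cancellation is quantified; S-E / (TD_A) stay CONJECTURED; records in print UNMOVED. Prover P2 g41 (SEQUEL,
file (7); plan INBOX 2026-08-28). Sources: P2 g40 `ConeGammaTranslateGradientLocal` / `ConeGammaTranslateGradient` (a separated
simple crossing: `floor_other_near_crossing`, `floor_self_at_crossing`, `r_mul_h28_le_one`; the per-period signed jump masses
`J_k(δ) = Σ_{z∈S_k} J_{k,z}` are the gradient of `P`), file (6) `ConeGammaTranslateUnitExchange` (`jump_exchange_of_swap`).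

* **`jump_eq_floorN_single`** — at a separated simple crossing `(k₀,z₀)` of a translate `δ` (time `s₀`, margin `r` from every
  crossing of every other form, `r·h_{k₀} ≤ 1`) the jump is the marginal of BZ's floor functional at the FROZEN floor vector of
  the window: `J_{k₀,z₀} = floorN(N⁰ + e_{k₀}) − floorN(N⁰)`, `N⁰_k = ⌊s₀·h_k + φ_kδ⌋` (`k ≠ k₀`), `N⁰_{k₀} = z₀ − 1` — the global
  analogue of file (1)'s `jump_eq_patternN_marginal` (which reads the same marginal at a junction of the closed orbit);
  `jump_eq_of_frozen_eq` — two translates with the same frozen floors at the crossing `(k₀,z₀)` have the same jump there;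
* **`jumpMass_sub_of_swap` — THE UNIT KINK, certificate-style.** Two translates `δ⁺`, `δ⁻` with margins and a period `T`, the SAME
  crossing windows (`⌊φ_kδ⁺⌋ = ⌊φ_kδ⁻⌋`), one pair `(k₁,z₁)`, `(k₂,z₂)` (`k₁ ≠ k₂`, both inside their windows) crossing in the order
  `k₁, k₂` in `δ⁺` and `k₂, k₁` in `δ⁻` inside double windows with agreeing frozen floors (file (6)'s hypotheses), and agreeing
  frozen floors at EVERY OTHER crossing of the period. Then for EVERY form `k`:
  **`J⁺_k − J⁻_k = m·([k = k₂] − [k = k₁])`**, `m = J⁺_{k₂,z₂} − J⁻_{k₂,z₂}`, **`|m| ≤ 1`** — the gradient of `P` (P2 g40) jumps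
  across the wall by `m·(φ_{k₂}/h_{k₂} − φ_{k₁}/h_{k₁})`, a UNIT multiple of the wall's own covector: every kink of `P` across a
  simple resonance wall is a unit kink (the translate-arrangement analogue of P2 g26's `D_b ∈ {−1,0,+1}`).
NOT here (honest): the EXISTENCE of such a pair `δ^±` on the two sides of a given wall point (the hypotheses are what a checker
verifies for two concrete translates; that generic wall points admit them is inspection, not filed); multiple resonances (several
pairs swapping at once — e.g. every chamber wall of the rate arrangement NEAR the closed orbit, where the bound is P2 g32's
junction count, not `1`); any value of `m` or any wall at a named direction; `Φ`, `γ`, C2, S-E's truth, `ζ(5)`.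
-/

noncomputable section

open Set MeasureTheory Finset
open scoped Topology

namespace Summit.KontsevichZagierPeriods.Zeta5Search.Barrier.ConeGamma

/-! ### The jump at a separated simple crossing is a marginal of the floor functional -/

/-- **THE JUMP AT A SEPARATED SIMPLE CROSSING IS THE MARGINAL OF THE FLOOR FUNCTIONAL AT THE FROZEN VECTOR.** All forms
positive; the crossing `(k₀,z₀)` of `δ` at `s₀ = (z₀ − φ_{k₀}δ)/h_{k₀}`, at distance `≥ r > 0` from every crossing of every other
form, `r·h_{k₀} ≤ 1`. Then `𝒩(θ_{s₀}) − 𝒩(θ_{s₀−r/2}) = floorN(N⁰ + e_{k₀}) − floorN(N⁰)` with `N⁰_k = ⌊s₀·h_k(a) + φ_kδ⌋` for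
`k ≠ k₀` and `N⁰_{k₀} = z₀ − 1`. -/
theorem jump_eq_floorN_single {a : Dir} (hpos : ∀ k, 0 < h28 a k) {δ : Fin 8 → ℝ} {r : ℝ} (hr : 0 < r)
    {k₀ : Fin 28} {z₀ : ℤ} (hr1 : r * h28 a k₀ ≤ 1)
    (hsep : ∀ (k : Fin 28) (z : ℤ), k ≠ k₀ →
      r ≤ |((z₀ : ℝ) - phiForm δ k₀) / h28 a k₀ - ((z : ℝ) - phiForm δ k) / h28 a k|)
    {N : Fin 28 → ℤ}
    (hN : ∀ k, N k = if k = k₀ then z₀ - 1 else ⌊((z₀ : ℝ) - phiForm δ k₀) / h28 a k₀ * h28 a k + phiForm δ k⌋) :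
    torusN ((((z₀ : ℝ) - phiForm δ k₀) / h28 a k₀) • sParam a + δ) -
        torusN ((((z₀ : ℝ) - phiForm δ k₀) / h28 a k₀ - r / 2) • sParam a + δ) =
      floorN (N + Pi.single k₀ 1) - floorN N := by
  set s₀ := ((z₀ : ℝ) - phiForm δ k₀) / h28 a k₀ with hs₀
  have h0 : ∀ k, |phiForm (0 : Fin 8 → ℝ) k| ≤ r * h28 a k / 4 := fun k => by
    rw [phiForm_zero, abs_zero]; have := hpos k; positivity
  obtain ⟨hselfA, hselfB⟩ := floor_self_at_crossing hpos δ hr k₀ z₀ hr1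
  -- the floors at `s₀`
  have eA : torusN (s₀ • sParam a + δ) = floorN (N + Pi.single k₀ 1) := by
    rw [torusN_eq_floorN]
    refine congrArg floorN (funext fun k => ?_)
    rw [Pi.add_apply, hN k]
    by_cases hk : k = k₀
    · subst hk
      rw [if_pos rfl, Pi.single_eq_same, hselfA]; ring
    · rw [if_neg hk, Pi.single_eq_of_ne hk, add_zero]
      have h := floor_other_near_crossing hpos hr hsep (u := s₀) (by rw [sub_self, abs_zero]; positivity) h0 hk
      rwa [add_zero] at h
  -- the floors at `s₀ − r/2`
  have eB : torusN ((s₀ - r / 2) • sParam a + δ) = floorN N := by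
    rw [torusN_eq_floorN]
    refine congrArg floorN (funext fun k => ?_)
    rw [hN k]
    by_cases hk : k = k₀
    · subst hk
      rw [if_pos rfl, hselfB]
    · rw [if_neg hk]
      have h := floor_other_near_crossing hpos hr hsep (u := s₀ - r / 2)
        (by rw [show s₀ - r / 2 - s₀ = -(r / 2) by ring, abs_neg, abs_of_pos (by positivity)]) h0 hk
      rwa [add_zero] at h
  rw [eA, eB]

/-- **Equal frozen floors ⇒ equal jumps.** Two translates `δ`, `δ'` with separated simple crossings `(k₀,z₀)` (margins `r`,
`r'`) and the same frozen floors there (`⌊s₀·h_k + φ_kδ⌋ = ⌊s₀'·h_k + φ_kδ'⌋` for `k ≠ k₀`) have the same jump at `(k₀,z₀)`. -/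
theorem jump_eq_of_frozen_eq {a : Dir} (hpos : ∀ k, 0 < h28 a k) {k₀ : Fin 28} {z₀ : ℤ}
    {δ : Fin 8 → ℝ} {r : ℝ} (hr : 0 < r) (hr1 : r * h28 a k₀ ≤ 1)
    (hsep : ∀ (k : Fin 28) (z : ℤ), k ≠ k₀ →
      r ≤ |((z₀ : ℝ) - phiForm δ k₀) / h28 a k₀ - ((z : ℝ) - phiForm δ k) / h28 a k|)
    {δ' : Fin 8 → ℝ} {r' : ℝ} (hr' : 0 < r') (hr1' : r' * h28 a k₀ ≤ 1)
    (hsep' : ∀ (k : Fin 28) (z : ℤ), k ≠ k₀ →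
      r' ≤ |((z₀ : ℝ) - phiForm δ' k₀) / h28 a k₀ - ((z : ℝ) - phiForm δ' k) / h28 a k|)
    (hagree : ∀ k, k ≠ k₀ → ⌊((z₀ : ℝ) - phiForm δ k₀) / h28 a k₀ * h28 a k + phiForm δ k⌋ =
      ⌊((z₀ : ℝ) - phiForm δ' k₀) / h28 a k₀ * h28 a k + phiForm δ' k⌋) :
    torusN ((((z₀ : ℝ) - phiForm δ k₀) / h28 a k₀) • sParam a + δ) -
        torusN ((((z₀ : ℝ) - phiForm δ k₀) / h28 a k₀ - r / 2) • sParam a + δ) =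
      torusN ((((z₀ : ℝ) - phiForm δ' k₀) / h28 a k₀) • sParam a + δ') -
        torusN ((((z₀ : ℝ) - phiForm δ' k₀) / h28 a k₀ - r' / 2) • sParam a + δ') := by
  set N : Fin 28 → ℤ := fun k => if k = k₀ then z₀ - 1
    else ⌊((z₀ : ℝ) - phiForm δ k₀) / h28 a k₀ * h28 a k + phiForm δ k⌋ with hNdef
  have hN : ∀ k, N k = if k = k₀ then z₀ - 1
      else ⌊((z₀ : ℝ) - phiForm δ k₀) / h28 a k₀ * h28 a k + phiForm δ k⌋ := fun k => rfl
  have hN' : ∀ k, N k = if k = k₀ then z₀ - 1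
      else ⌊((z₀ : ℝ) - phiForm δ' k₀) / h28 a k₀ * h28 a k + phiForm δ' k⌋ := fun k => by
    rw [hN k]
    by_cases hk : k = k₀
    · rw [if_pos hk, if_pos hk]
    · rw [if_neg hk, if_neg hk, hagree k hk]
  rw [jump_eq_floorN_single hpos hr hr1 hsep hN, jump_eq_floorN_single hpos hr' hr1' hsep' hN']

/-! ### The unit kink -/

/-- **EVERY KINK OF `P` ACROSS A SIMPLE RESONANCE WALL IS A UNIT KINK (certificate-style).** All forms of `a` positive, `T` a
period; two translates `δ⁺` (margin `r⁺`) and `δ⁻` (margin `r⁻`) with the SAME crossing windows (`⌊φ_kδ⁺⌋ = ⌊φ_kδ⁻⌋`); a pair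
`(k₁,z₁)`, `(k₂,z₂)`, `k₁ ≠ k₂`, inside the windows, crossing in the order `k₁, k₂` in `δ⁺` and `k₂, k₁` in `δ⁻` inside double windows
(file (6): radii `R⁺`, `R⁻`) whose frozen floors agree; and at every OTHER crossing `(k,z)` of the period the frozen floors of
`δ⁺` and `δ⁻` agree. Then, with `m = J⁺_{k₂,z₂} − J⁻_{k₂,z₂}`: `|m| ≤ 1` and for EVERY form `k`
`J⁺_k − J⁻_k = m·([k = k₂] − [k = k₁])` — the per-period signed jump masses (the gradient of `P`) change across the wall by the
unit exchange `m·(e_{k₂} − e_{k₁})` and by nothing else. -/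
theorem jumpMass_sub_of_swap {a : Dir} (hpos : ∀ k, 0 < h28 a k) {T : ℝ} {k₁ k₂ : Fin 28} (hk : k₁ ≠ k₂) {z₁ z₂ : ℤ}
    {δp : Fin 8 → ℝ} {rp : ℝ} (hrp : 0 < rp)
    (hsepp : ∀ (k k' : Fin 28) (z z' : ℤ), (k ≠ k' ∨ z ≠ z') →
      rp ≤ |((z : ℝ) - phiForm δp k) / h28 a k - ((z' : ℝ) - phiForm δp k') / h28 a k'|)
    {Rp : ℝ} (hltp : ((z₁ : ℝ) - phiForm δp k₁) / h28 a k₁ < ((z₂ : ℝ) - phiForm δp k₂) / h28 a k₂)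
    (hclosep : ((z₂ : ℝ) - phiForm δp k₂) / h28 a k₂ - ((z₁ : ℝ) - phiForm δp k₁) / h28 a k₁ ≤ Rp / 2)
    (hrRp : rp ≤ Rp / 2) (hRxp : Rp * xMax a ≤ 1)
    (hfarp : ∀ (k : Fin 28) (z : ℤ), ¬(k = k₁ ∧ z = z₁) → ¬(k = k₂ ∧ z = z₂) →
      Rp ≤ |((z₁ : ℝ) - phiForm δp k₁) / h28 a k₁ - ((z : ℝ) - phiForm δp k) / h28 a k|)
    {δm : Fin 8 → ℝ} {rm : ℝ} (hrm : 0 < rm)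
    (hsepm : ∀ (k k' : Fin 28) (z z' : ℤ), (k ≠ k' ∨ z ≠ z') →
      rm ≤ |((z : ℝ) - phiForm δm k) / h28 a k - ((z' : ℝ) - phiForm δm k') / h28 a k'|)
    {Rm : ℝ} (hltm : ((z₂ : ℝ) - phiForm δm k₂) / h28 a k₂ < ((z₁ : ℝ) - phiForm δm k₁) / h28 a k₁)
    (hclosem : ((z₁ : ℝ) - phiForm δm k₁) / h28 a k₁ - ((z₂ : ℝ) - phiForm δm k₂) / h28 a k₂ ≤ Rm / 2)
    (hrRm : rm ≤ Rm / 2) (hRxm : Rm * xMax a ≤ 1)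
    (hfarm : ∀ (k : Fin 28) (z : ℤ), ¬(k = k₂ ∧ z = z₂) → ¬(k = k₁ ∧ z = z₁) →
      Rm ≤ |((z₂ : ℝ) - phiForm δm k₂) / h28 a k₂ - ((z : ℝ) - phiForm δm k) / h28 a k|)
    (hagree : ∀ k, k ≠ k₁ → k ≠ k₂ →
      ⌊((z₁ : ℝ) - phiForm δp k₁) / h28 a k₁ * h28 a k + phiForm δp k⌋ =
        ⌊((z₂ : ℝ) - phiForm δm k₂) / h28 a k₂ * h28 a k + phiForm δm k⌋)
    (hwin : ∀ k, ⌊phiForm δp k⌋ = ⌊phiForm δm k⌋)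
    (hz₁ : z₁ ∈ Finset.Ioc ⌊phiForm δp k₁⌋ (⌊phiForm δp k₁⌋ + ⌊T * h28 a k₁⌋))
    (hz₂ : z₂ ∈ Finset.Ioc ⌊phiForm δp k₂⌋ (⌊phiForm δp k₂⌋ + ⌊T * h28 a k₂⌋))
    (hother : ∀ (k : Fin 28) (z : ℤ), z ∈ Finset.Ioc ⌊phiForm δp k⌋ (⌊phiForm δp k⌋ + ⌊T * h28 a k⌋) →
      ¬(k = k₁ ∧ z = z₁) → ¬(k = k₂ ∧ z = z₂) → ∀ l, l ≠ k →
        ⌊((z : ℝ) - phiForm δp k) / h28 a k * h28 a l + phiForm δp l⌋ =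
          ⌊((z : ℝ) - phiForm δm k) / h28 a k * h28 a l + phiForm δm l⌋) (k : Fin 28) :
    |torusN ((((z₂ : ℝ) - phiForm δp k₂) / h28 a k₂) • sParam a + δp) -
          torusN ((((z₂ : ℝ) - phiForm δp k₂) / h28 a k₂ - rp / 2) • sParam a + δp) -
        (torusN ((((z₂ : ℝ) - phiForm δm k₂) / h28 a k₂) • sParam a + δm) -
          torusN ((((z₂ : ℝ) - phiForm δm k₂) / h28 a k₂ - rm / 2) • sParam a + δm))| ≤ 1 ∧
    (∑ z ∈ Finset.Ioc ⌊phiForm δp k⌋ (⌊phiForm δp k⌋ + ⌊T * h28 a k⌋),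
        (torusN ((((z : ℝ) - phiForm δp k) / h28 a k) • sParam a + δp) -
          torusN ((((z : ℝ) - phiForm δp k) / h28 a k - rp / 2) • sParam a + δp))) -
      (∑ z ∈ Finset.Ioc ⌊phiForm δm k⌋ (⌊phiForm δm k⌋ + ⌊T * h28 a k⌋),
        (torusN ((((z : ℝ) - phiForm δm k) / h28 a k) • sParam a + δm) -
          torusN ((((z : ℝ) - phiForm δm k) / h28 a k - rm / 2) • sParam a + δm))) =
      (torusN ((((z₂ : ℝ) - phiForm δp k₂) / h28 a k₂) • sParam a + δp) -
          torusN ((((z₂ : ℝ) - phiForm δp k₂) / h28 a k₂ - rp / 2) • sParam a + δp) -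
        (torusN ((((z₂ : ℝ) - phiForm δm k₂) / h28 a k₂) • sParam a + δm) -
          torusN ((((z₂ : ℝ) - phiForm δm k₂) / h28 a k₂ - rm / 2) • sParam a + δm))) *
        ((if k = k₂ then 1 else 0) - (if k = k₁ then 1 else 0)) := by
  obtain ⟨hsum, hanti, habs⟩ := jump_exchange_of_swap hpos hk hrp hsepp hltp hclosep hrRp hRxp hfarp hrm hsepm hltm
    hclosem hrRm hRxm hfarm hagree
  -- the jump functions of the two translates
  set Jp : Fin 28 → ℤ → ℤ := fun k z => torusN ((((z : ℝ) - phiForm δp k) / h28 a k) • sParam a + δp) -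
    torusN ((((z : ℝ) - phiForm δp k) / h28 a k - rp / 2) • sParam a + δp) with hJp
  set Jm : Fin 28 → ℤ → ℤ := fun k z => torusN ((((z : ℝ) - phiForm δm k) / h28 a k) • sParam a + δm) -
    torusN ((((z : ℝ) - phiForm δm k) / h28 a k - rm / 2) • sParam a + δm) with hJm
  -- the exchange `m` in the two forms
  have hm2 : Jp k₂ z₂ - Jm k₂ z₂ = -(Jp k₁ z₁ - Jm k₁ z₁) := by
    simp only [hJp, hJm]; linarith
  refine ⟨?_, ?_⟩
  · change |Jp k₂ z₂ - Jm k₂ z₂| ≤ 1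
    rw [hm2, abs_neg]
    exact habs
  -- every OTHER jump agrees
  have hsame : ∀ (k : Fin 28) (z : ℤ), z ∈ Finset.Ioc ⌊phiForm δp k⌋ (⌊phiForm δp k⌋ + ⌊T * h28 a k⌋) →
      ¬(k = k₁ ∧ z = z₁) → ¬(k = k₂ ∧ z = z₂) → Jp k z = Jm k z := by
    intro k z hz h1 h2
    simp only [hJp, hJm]
    exact jump_eq_of_frozen_eq hpos hrp (r_mul_h28_le_one hpos hsepp k)
      (fun k' z' hk' => hsepp k k' z z' (Or.inl (Ne.symm hk'))) hrm (r_mul_h28_le_one hpos hsepm k)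
      (fun k' z' hk' => hsepm k k' z z' (Or.inl (Ne.symm hk'))) (hother k z hz h1 h2)
  -- the two sums differ only at the swapped pair
  rw [← hwin k]
  change (∑ z ∈ _, Jp k z) - (∑ z ∈ _, Jm k z) = (Jp k₂ z₂ - Jm k₂ z₂) * _
  rw [← Finset.sum_sub_distrib]
  by_cases hk1 : k = k₁
  · subst hk1
    rw [if_neg hk, if_pos rfl, Finset.sum_eq_single z₁]
    · rw [hm2]; ring
    · intro z hz hne
      rw [sub_eq_zero]
      exact hsame k z hz (fun h => hne h.2) (fun h => hk h.1)
    · intro h; exact absurd hz₁ h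
  · by_cases hk2 : k = k₂
    · subst hk2
      rw [if_pos rfl, if_neg hk1, Finset.sum_eq_single z₂]
      · ring
      · intro z hz hne
        rw [sub_eq_zero]
        exact hsame k z hz (fun h => hk1 h.1) (fun h => hne h.2)
      · intro h; exact absurd hz₂ h
    · rw [if_neg hk2, if_neg hk1, sub_self, mul_zero]
      exact Finset.sum_eq_zero fun z hz => by
        rw [sub_eq_zero]; exact hsame k z hz (fun h => hk1 h.1) (fun h => hk2 h.1)

end Summit.KontsevichZagierPeriods.Zeta5Search.Barrier.ConeGamma

end
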